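import Summits.QuantumFields.QCD.Theses.NestedDissectionSea
import Literature.Barriers.QuantumFields.ElitzurTheorem
import HarnessLib

/-!
# Haar averaging over block gauge transformations — toolkit for `stub_gaugeAveraging`

Context-free lemmas (torus `(ZMod L)^d`, compact second-countable gauge group `G`) behind Stub 3
(`stub_gaugeAveraging`) of the line `birth` on the crux `RobustYangMillsRG` (stmt-QuantumFields-17812):
product probability measures (functions of disjoint coordinate blocks are uncorrelated —
`pi_integral_mul_of_dependsOn`, Mathlib `iIndepFun_pi`; relabelling — `pi_integral_comp_equiv`);
algebra of gauge transformations (composition, locality in `V` and in `g`, intertwining with torus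
translations); the Haar average `V ↦ ∫ G(g • V) dg` over ALL gauge transformations (measurable,
bounded, gauge invariant, same slab support, same blocked expectation under a gauge-invariant fine
weight and a covariant blocking — `integral_haarAvg_block_mul`; factorisation of the average of
`G₁ · (G₂ ∘ τ_t)` for separated gauge supports — `haarAvg_mul_shift`, whose `SU(3)`, `d = 4` instance
is the registered sub-goal `stub_gaugeAveraging_haarFactorisation`).
References: Osterwalder–Seiler, Ann. Phys. 110 (1978) 440 [OsterwalderSeilerAnnPhys1978]; Wipf 2021
§13.5.2 (gauge averaging inside the functional integral, as in the tree's `ElitzurTheorem`).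
-/

namespace Summit.QuantumFields.QCD.Cruxes.RobustYangMillsRG.Birth

open scoped BigOperators Topology Manifold Classical MeasureTheory ProbabilityTheory Matrix
  InnerProductSpace ComplexConjugate ContinuousMap
open Filter Set Function TopologicalSpace MeasureTheory
open Literature.MathematicalPhysics.QuantumLattice Literature.MathematicalPhysics.AQFT
  Literature.MathematicalPhysics.QuantumFieldTheory

namespace GaugeAveraging

/-! ### Product probability measures -/

section Pi

variable {ι Ω : Type*} [Fintype ι] [MeasurableSpace Ω]

/-- **Disjoint coordinate blocks of a product probability measure are independent**: if `F₁`
depends only on the coordinates in `S` and `F₂` only on those in `Sᶜ`, then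
`∫ F₁ F₂ dμ^{⊗ι} = (∫ F₁ dμ^{⊗ι}) (∫ F₂ dμ^{⊗ι})` (Mathlib `iIndepFun_pi`,
`iIndepFun.indepFun_finset`, `IndepFun.integral_fun_mul_eq_mul_integral`). [folklore] -/
theorem pi_integral_mul_of_dependsOn (μ : Measure Ω) [IsProbabilityMeasure μ] (ω₀ : Ω)
    (S : Set ι) {F₁ F₂ : (ι → Ω) → ℝ} (hF₁ : Measurable F₁) (hF₂ : Measurable F₂)
    (h₁ : DependsOn F₁ S) (h₂ : DependsOn F₂ Sᶜ) :
    ∫ x, F₁ x * F₂ x ∂Measure.pi (fun _ : ι => μ) =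
      (∫ x, F₁ x ∂Measure.pi (fun _ : ι => μ)) * ∫ x, F₂ x ∂Measure.pi (fun _ : ι => μ) := by
  classical
  set A : Finset ι := Finset.univ.filter (· ∈ S) with hA
  set B : Finset ι := Finset.univ.filter (· ∉ S) with hB
  have hAB : Disjoint A B := by
    rw [Finset.disjoint_left]
    intro i hiA hiB
    simp only [hA, hB, Finset.mem_filter, Finset.mem_univ, true_and] at hiA hiB
    exact hiB hiA
  have hind : ProbabilityTheory.iIndepFun (fun (i : ι) (x : ι → Ω) => x i)
      (Measure.pi fun _ : ι => μ) :=
    ProbabilityTheory.iIndepFun_pi (μ := fun _ : ι => μ) (X := fun _ => id) fun _ => aemeasurable_id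
  have hXY := hind.indepFun_finset A B hAB fun i => measurable_pi_apply i
  have hcomp := hXY.comp
    (hF₁.comp (measurable_updateFinset (x := fun _ : ι => ω₀) (s := A)))
    (hF₂.comp (measurable_updateFinset (x := fun _ : ι => ω₀) (s := B)))
  have heq₁ :
      ((F₁ ∘ Function.updateFinset (fun _ : ι => ω₀) A) ∘ fun (x : ι → Ω) (i : A) => x i)
        = F₁ := by
    funext x
    refine h₁ fun i hi => ?_
    have hiA : i ∈ A := by simp [hA, hi]
    simp [Function.updateFinset_def, hiA]
  have heq₂ :
      ((F₂ ∘ Function.updateFinset (fun _ : ι => ω₀) B) ∘ fun (x : ι → Ω) (i : B) => x i)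
        = F₂ := by
    funext x
    refine h₂ fun i hi => ?_
    have hiB : i ∈ B := by simpa [hB] using hi
    simp [Function.updateFinset_def, hiB]
  rw [heq₁, heq₂] at hcomp
  exact hcomp.integral_fun_mul_eq_mul_integral hF₁.aestronglyMeasurable
    hF₂.aestronglyMeasurable

/-- **Relabelling invariance of a product of identical measures**:
`∫ Φ(x ∘ σ) dμ^{⊗ι} = ∫ Φ dμ^{⊗ι}` for every permutation `σ` of the index set (Mathlib
`measurePreserving_arrowCongr'`). [folklore] -/
theorem pi_integral_comp_equiv (μ : Measure Ω) [SigmaFinite μ] (σ : ι ≃ ι) (Φ : (ι → Ω) → ℝ) :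
    ∫ x, Φ (x ∘ σ) ∂Measure.pi (fun _ : ι => μ) = ∫ x, Φ x ∂Measure.pi (fun _ : ι => μ) := by
  have hmp := measurePreserving_arrowCongr' (fun _ : ι => μ) (fun _ : ι => μ) σ.symm
    (MeasurableEquiv.refl Ω) fun _ => MeasurePreserving.id μ
  exact hmp.integral_comp' Φ

end Pi

/-! ### Gauge transformations: algebra and locality -/

section Algebra

variable {d L : ℕ} {G : Type*} [Group G]

/-- Composition of gauge transformations: `g • (g₀ • V) = (g g₀) • V`. [folklore] -/
theorem gaugeTransform_gaugeTransform (g g₀ : Site d L → G) (V : GaugeConfig d L G) :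
    gaugeTransform g (gaugeTransform g₀ V) = gaugeTransform (g * g₀) V := by
  funext e
  simp only [gaugeTransform, Pi.mul_apply, mul_inv_rev, mul_assoc]

/-- Locality in the configuration: if `F` depends only on the links in `S`, so does `F(g • ·)`
(a gauge transformation acts link by link). [folklore] -/
theorem dependsOn_gaugeTransform_right {β : Type*} {S : Set (Edge d L)}
    {F : GaugeConfig d L G → β} (hF : DependsOn F S) (g : Site d L → G) :
    DependsOn (fun V => F (gaugeTransform g V)) S := by
  intro V V' hVV'
  exact hF fun e he => by simp only [gaugeTransform, hVV' e he]

/-- Locality in the gauge field: if `F` depends only on the links in `S` and `T` contains both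
endpoints of every link of `S`, then `g ↦ F(g • V)` depends only on `g|_T`. [folklore] -/
theorem dependsOn_gaugeTransform_left {β : Type*} {S : Set (Edge d L)} {T : Set (Site d L)}
    {F : GaugeConfig d L G → β} (hF : DependsOn F S)
    (hT : ∀ e ∈ S, e.1 ∈ T ∧ e.1.shift e.2 ∈ T) (V : GaugeConfig d L G) :
    DependsOn (fun g : Site d L → G => F (gaugeTransform g V)) T := by
  intro g g' hgg'
  exact hF fun e he => by simp only [gaugeTransform, hgg' _ (hT e he).1, hgg' _ (hT e he).2]

/-- **Translations intertwine gauge transformations**: `τ_v (g • V) = (g ∘ (· - v)) • τ_v V`,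
where `(τ_v V)(x, i) = V(x - v, i)` (tree `torusConfigShift_apply`). [folklore] -/
theorem torusConfigShift_gaugeTransform [MeasurableSpace G] (v : Site d L) (g : Site d L → G)
    (V : GaugeConfig d L G) :
    torusConfigShift v (gaugeTransform g V) =
      gaugeTransform (g ∘ fun x => x - v) (torusConfigShift v V) := by
  funext e
  simp only [torusConfigShift_apply, gaugeTransform, Function.comp_apply, Site.shift,
    sub_add_eq_add_sub]

/-- Joint continuity of the gauge action `(g, V) ↦ g • V` (each link is a product of coordinate
projections and inverses). [folklore] -/
theorem continuous_gaugeTransform₂ [TopologicalSpace G] [ContinuousMul G] [ContinuousInv G] :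
    Continuous fun p : (Site d L → G) × GaugeConfig d L G => gaugeTransform p.1 p.2 := by
  refine continuous_pi fun e => ?_
  show Continuous fun p : (Site d L → G) × GaugeConfig d L G =>
    p.1 e.1 * p.2 e * (p.1 (e.1.shift e.2))⁻¹
  exact (((continuous_apply e.1).comp continuous_fst).mul
    ((continuous_apply e).comp continuous_snd)).mul
      (((continuous_apply (e.1.shift e.2)).comp continuous_fst).inv)

end Algebra

/-! ### Slab geometry on the time circle `ZMod M` -/

section Slab

variable {d M : ℕ} [NeZero d]

/-- Both endpoints of a link starting at time `< h` have time `≤ h`. [folklore] -/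
theorem endpoints_mem_of_time_lt {h : ℕ} (e : Edge d M) (he : (e.1 0).val < h) :
    (e.1 0).val ≤ h ∧ ((e.1.shift e.2) 0).val ≤ h := by
  refine ⟨he.le, ?_⟩
  have h1 : (Pi.single (M := fun _ : Fin d => ZMod M) e.2 (1 : ZMod M) 0).val ≤ 1 := by
    rw [Pi.single_apply]
    split_ifs
    · rw [ZMod.val_one_eq_one_mod]; exact Nat.mod_le 1 M
    · rw [ZMod.val_zero]; exact Nat.zero_le 1
  have h2 := ZMod.val_add_le (e.1 0) (Pi.single (M := fun _ : Fin d => ZMod M) e.2 (1 : ZMod M) 0)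
  simp only [Site.shift, Pi.add_apply]
  omega

/-- For `h < t ≤ M/2`: a site of time `≤ h`, translated back by `t`, has time `> h` (no
wrap-around conflict: `t + h < 2t ≤ M`). [folklore] -/
theorem not_time_le_of_sub [NeZero M] {h t : ℕ} (hht : h < t) (h2t : 2 * t ≤ M) (x : Site d M)
    (hx : (x 0).val ≤ h) : ¬ ((x - (Pi.single 0 (t : ZMod M) : Site d M)) 0).val ≤ h := by
  intro hx'
  have htM : t < M := by omega
  have htval : (t : ZMod M).val = t := by rw [ZMod.val_natCast, Nat.mod_eq_of_lt htM]
  set y : ZMod M := (x - (Pi.single 0 (t : ZMod M) : Site d M)) 0 with hy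
  have hx0 : x 0 = y + (t : ZMod M) := by simp [hy]
  have hval : (x 0).val = y.val + t := by
    rw [hx0, ZMod.val_add, htval, Nat.mod_eq_of_lt (by omega)]
  omega

/-- Time `< h` after translating by `t ≤ h` means time `< 2h` relative to the base `-t`:
`(x₀ + t).val < 2h` whenever `x₀.val < h`. [folklore] -/
theorem time_add_lt_two_mul {h t : ℕ} (hth : t ≤ h) (x₀ : ZMod M) (hx : x₀.val < h) :
    (x₀ - -(t : ZMod M)).val < 2 * h := by
  rw [sub_neg_eq_add]
  have h1 := ZMod.val_add_le x₀ (t : ZMod M)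
  have h2 : (t : ZMod M).val ≤ t := by rw [ZMod.val_natCast]; exact Nat.mod_le t M
  omega

end Slab

/-! ### The Haar average over all gauge transformations -/

section Haar

variable {d L : ℕ} {G : Type*} [Group G] [TopologicalSpace G] [IsTopologicalGroup G]
  [CompactSpace G] [SecondCountableTopology G] [MeasurableSpace G] [BorelSpace G] [NeZero L]

omit [CompactSpace G] in
/-- The joint gauge action is measurable (second countability of `G`). [folklore] -/
theorem measurable_gaugeTransform₂ :
    Measurable fun p : (Site d L → G) × GaugeConfig d L G => gaugeTransform p.1 p.2 :=
  continuous_gaugeTransform₂.measurable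

omit [CompactSpace G] in
/-- For a fixed gauge field, `V ↦ g • V` is measurable. [folklore] -/
theorem measurable_gaugeTransform_right (g : Site d L → G) :
    Measurable (gaugeTransform g : GaugeConfig d L G → GaugeConfig d L G) :=
  measurable_gaugeTransform₂.comp (measurable_const.prodMk measurable_id)

omit [CompactSpace G] in
/-- For a fixed configuration, `g ↦ g • V` is measurable. [folklore] -/
theorem measurable_gaugeTransform_left (V : GaugeConfig d L G) :
    Measurable fun g : Site d L → G => gaugeTransform g V :=
  measurable_gaugeTransform₂.comp (measurable_id.prodMk measurable_const)

/-- **The Haar average `V ↦ ∫ F(g • V) dg` is measurable** (Fubini–Tonelli measurability,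
Mathlib `StronglyMeasurable.integral_prod_left'`). [folklore] -/
theorem measurable_haarAvg {F : GaugeConfig d L G → ℝ} (hF : Measurable F) :
    Measurable fun V : GaugeConfig d L G =>
      ∫ g, F (gaugeTransform g V) ∂Measure.pi fun _ : Site d L => haarProbability G := by
  have h : StronglyMeasurable fun p : (Site d L → G) × GaugeConfig d L G =>
      F (gaugeTransform p.1 p.2) :=
    (hF.comp measurable_gaugeTransform₂).stronglyMeasurable
  exact (h.integral_prod_left' (μ := Measure.pi fun _ : Site d L => haarProbability G)).measurable

omit [SecondCountableTopology G] in
/-- The Haar average inherits the bound `|F| ≤ C` (probability measure). [folklore] -/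
theorem abs_haarAvg_le {F : GaugeConfig d L G → ℝ} {C : ℝ} (hC : ∀ V, |F V| ≤ C)
    (V : GaugeConfig d L G) :
    |∫ g, F (gaugeTransform g V) ∂Measure.pi fun _ : Site d L => haarProbability G| ≤ C := by
  have := norm_integral_le_of_norm_le_const (μ := Measure.pi fun _ : Site d L => haarProbability G)
    (f := fun g : Site d L → G => F (gaugeTransform g V)) (C := C)
    (ae_of_all _ fun g => by simpa only [Real.norm_eq_abs] using hC (gaugeTransform g V))
  simpa [Real.norm_eq_abs, probReal_univ] using this

/-- Right translations `g ↦ g g₀` preserve the product Haar measure on gauge fields (compact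
groups are unimodular; tree `measurePreserving_mul_mul_inv_haarProbability`). [folklore] -/
theorem measurePreserving_mul_right_pi (g₀ : Site d L → G) :
    MeasurePreserving (fun g : Site d L → G => g * g₀)
      (Measure.pi fun _ : Site d L => haarProbability G)
      (Measure.pi fun _ : Site d L => haarProbability G) := by
  have := measurePreserving_pi (f := fun (i : Site d L) (x : G) => 1 * x * (g₀ i)⁻¹⁻¹)
    (fun _ : Site d L => haarProbability G) (fun _ : Site d L => haarProbability G)
    (fun i => measurePreserving_mul_mul_inv_haarProbability (1 : G) (g₀ i)⁻¹)
  convert this using 1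
  funext g; funext i; simp [Pi.mul_apply]

/-- **The Haar average is gauge invariant**: `∫ F(g • (g₀ • V)) dg = ∫ F(g • V) dg`
(composition and right invariance of `Haar^{⊗Λ}`). [folklore] -/
theorem haarAvg_gaugeTransform (F : GaugeConfig d L G → ℝ) (g₀ : Site d L → G)
    (V : GaugeConfig d L G) :
    ∫ g, F (gaugeTransform g (gaugeTransform g₀ V))
        ∂Measure.pi (fun _ : Site d L => haarProbability G)
      = ∫ g, F (gaugeTransform g V) ∂Measure.pi fun _ : Site d L => haarProbability G := by
  simp only [gaugeTransform_gaugeTransform]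
  have hmp : MeasurePreserving (MeasurableEquiv.mulRight g₀)
      (Measure.pi fun _ : Site d L => haarProbability G)
      (Measure.pi fun _ : Site d L => haarProbability G) := by
    rw [MeasurableEquiv.coe_mulRight]
    exact measurePreserving_mul_right_pi g₀
  simpa [MeasurableEquiv.coe_mulRight] using
    hmp.integral_comp' (fun g => F (gaugeTransform g V))

omit [SecondCountableTopology G] in
/-- The Haar average has the same (link) support as `F`. [folklore] -/
theorem dependsOn_haarAvg {S : Set (Edge d L)} {F : GaugeConfig d L G → ℝ}
    (hF : DependsOn F S) :
    DependsOn (fun V : GaugeConfig d L G =>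
      ∫ g, F (gaugeTransform g V) ∂Measure.pi fun _ : Site d L => haarProbability G) S := by
  intro V V' hVV'
  dsimp only
  congr 1
  funext g
  exact dependsOn_gaugeTransform_right hF g hVV'

/-- Haar-averaging a translated observable: `∫ F(τ_v (g • V)) dg = ∫ F(g • τ_v V) dg`
(intertwining `τ_v (g • V) = (g ∘ (· - v)) • τ_v V` and relabelling invariance of `Haar^{⊗Λ}`).
[folklore] -/
theorem haarAvg_shift (F : GaugeConfig d L G → ℝ) (v : Site d L) (V : GaugeConfig d L G) :
    ∫ g, F (torusConfigShift v (gaugeTransform g V))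
        ∂Measure.pi (fun _ : Site d L => haarProbability G)
      = ∫ g, F (gaugeTransform g (torusConfigShift v V))
          ∂Measure.pi fun _ : Site d L => haarProbability G := by
  simp only [torusConfigShift_gaugeTransform]
  exact pi_integral_comp_equiv (haarProbability G) (Equiv.subRight v)
    (fun g => F (gaugeTransform g (torusConfigShift v V)))

/-- **Factorisation of the joint Haar average for separated gauge supports.** For slab
observables `F₁, F₂` supported on links of time `< h` and a time shift `t` with `h < t`,
`2t ≤ M`: `g ↦ F₁(g • V)` depends on `g` at times `≤ h` only, `g ↦ F₂(τ_t(g • V))` at times in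
`[M - t, M - t + h]` only; these site sets are disjoint, so under `Haar^{⊗Λ}` the average of the
product is the product of the averages, the second being the average of `F₂` at `τ_t V`.
[folklore] -/
theorem haarAvg_mul_shift [NeZero d] {h t : ℕ} (hht : h < t) (h2t : 2 * t ≤ L)
    {F₁ F₂ : GaugeConfig d L G → ℝ} (hF₁ : Measurable F₁) (hF₂ : Measurable F₂)
    (hd₁ : DependsOn F₁ {e | (e.1 0).val < h}) (hd₂ : DependsOn F₂ {e | (e.1 0).val < h})
    (V : GaugeConfig d L G) :
    ∫ g, F₁ (gaugeTransform g V) *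
        F₂ (torusConfigShift (Pi.single 0 (t : ZMod L)) (gaugeTransform g V))
        ∂Measure.pi (fun _ : Site d L => haarProbability G)
      = (∫ g, F₁ (gaugeTransform g V) ∂Measure.pi (fun _ : Site d L => haarProbability G)) *
        ∫ g, F₂ (gaugeTransform g (torusConfigShift (Pi.single 0 (t : ZMod L)) V))
          ∂Measure.pi fun _ : Site d L => haarProbability G := by
  set v : Site d L := Pi.single 0 (t : ZMod L) with hv
  set A : Set (Site d L) := {x | (x 0).val ≤ h} with hA
  simp only [torusConfigShift_gaugeTransform]
  have hΦ₁ : DependsOn (fun g : Site d L → G => F₁ (gaugeTransform g V)) A :=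
    dependsOn_gaugeTransform_left hd₁ (fun e he => endpoints_mem_of_time_lt e he) V
  have hΦ₂ : DependsOn (fun g : Site d L → G =>
      F₂ (gaugeTransform (g ∘ fun x => x - v) (torusConfigShift v V))) Aᶜ := by
    intro g g' hgg'
    refine dependsOn_gaugeTransform_left hd₂ (T := A)
      (fun e he => endpoints_mem_of_time_lt e he) (torusConfigShift v V) fun x hx => ?_
    exact hgg' (x - v) (not_time_le_of_sub hht h2t x hx)
  have hm₁ : Measurable fun g : Site d L → G => F₁ (gaugeTransform g V) :=
    hF₁.comp (measurable_gaugeTransform_left V)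
  have hmσ : Measurable fun g : Site d L → G => g ∘ fun x => x - v :=
    measurable_pi_lambda _ fun x => measurable_pi_apply (x - v)
  have hm₂ : Measurable fun g : Site d L → G =>
      F₂ (gaugeTransform (g ∘ fun x => x - v) (torusConfigShift v V)) :=
    hF₂.comp ((measurable_gaugeTransform_left (torusConfigShift v V)).comp hmσ)
  rw [pi_integral_mul_of_dependsOn (haarProbability G) 1 A hm₁ hm₂ hΦ₁ hΦ₂]
  congr 1
  exact pi_integral_comp_equiv (haarProbability G) (Equiv.subRight v)
    (fun g => F₂ (gaugeTransform g (torusConfigShift v V)))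

/-! ### Block gauge invariance of the blocked state -/

variable {N : ℕ}

omit [SecondCountableTopology G] [NeZero L] in
/-- **Block gauge invariance of the (un-normalised) blocked state.** If the fine weight `w` is
gauge invariant and the blocking `Bl` is covariant along an injective corner map `cor`
(`Bl(γ • U) = (γ ∘ cor) • Bl U`), then `∫ f(g • Bl U) w(U) dU = ∫ f(Bl U) w(U) dU` for every block
gauge field `g` (lift `g = γ ∘ cor` by `Function.extend`, then change variables `U ↦ γ • U`,
tree `Elitzur.integral_comp_gaugeTransform`). [folklore] -/
theorem integral_gaugeTransform_block_mul [NeZero N] {cor : Site d L → Site d N}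
    (hcor : Injective cor)
    {Bl : GaugeConfig d N G → GaugeConfig d L G}
    (hcov : ∀ γ U, Bl (gaugeTransform γ U) = gaugeTransform (γ ∘ cor) (Bl U))
    {w : GaugeConfig d N G → ℝ} (hw : ∀ γ U, w (gaugeTransform γ U) = w U)
    (f : GaugeConfig d L G → ℝ) (g : Site d L → G) :
    ∫ U, f (gaugeTransform g (Bl U)) * w U ∂Measure.pi (fun _ : Edge d N => haarProbability G)
      = ∫ U, f (Bl U) * w U ∂Measure.pi fun _ : Edge d N => haarProbability G := by
  set γ : Site d N → G := Function.extend cor g (fun _ => 1) with hγ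
  have hγc : γ ∘ cor = g := funext fun y => hcor.extend_apply g (fun _ => 1) y
  have h1 : (fun U => f (gaugeTransform g (Bl U)) * w U) =
      fun U => (fun U' => f (Bl U') * w U') (gaugeTransform γ U) := by
    funext U
    simp only [hcov, hγc, hw]
  rw [h1]
  exact Literature.Barriers.QuantumFields.Elitzur.integral_comp_gaugeTransform γ
    (fun U' => f (Bl U') * w U')

/-- **The Haar average has the same blocked expectation**: for bounded measurable `F`,
`∫ F̄(Bl U) w(U) dU = ∫ F(Bl U) w(U) dU`, `F̄(V) = ∫ F(g • V) dg` (Fubini over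
`Haar^{⊗Λ} ⊗ Haar^{⊗E}` and block gauge invariance of the state, pointwise in `g`). [folklore] -/
theorem integral_haarAvg_block_mul [NeZero N] {cor : Site d L → Site d N}
    (hcor : Injective cor)
    {Bl : GaugeConfig d N G → GaugeConfig d L G} (hBl : Measurable Bl)
    (hcov : ∀ γ U, Bl (gaugeTransform γ U) = gaugeTransform (γ ∘ cor) (Bl U))
    {w : GaugeConfig d N G → ℝ} (hwm : Measurable w)
    (hwi : Integrable w (Measure.pi fun _ : Edge d N => haarProbability G))
    (hw : ∀ γ U, w (gaugeTransform γ U) = w U)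
    {F : GaugeConfig d L G → ℝ} (hF : Measurable F) {C : ℝ} (hC : ∀ V, |F V| ≤ C) :
    ∫ U, (∫ g, F (gaugeTransform g (Bl U)) ∂Measure.pi (fun _ : Site d L => haarProbability G))
          * w U ∂Measure.pi (fun _ : Edge d N => haarProbability G)
      = ∫ U, F (Bl U) * w U ∂Measure.pi fun _ : Edge d N => haarProbability G := by
  set μ : Measure (GaugeConfig d N G) := Measure.pi fun _ : Edge d N => haarProbability G with hμ
  set π : Measure (Site d L → G) := Measure.pi fun _ : Site d L => haarProbability G with hπ
  haveI : IsProbabilityMeasure π := by rw [hπ]; infer_instance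
  have hA : ∀ g : Site d L → G,
      ∫ U, F (gaugeTransform g (Bl U)) * w U ∂μ = ∫ U, F (Bl U) * w U ∂μ :=
    fun g => integral_gaugeTransform_block_mul hcor hcov hw F g
  have hint : Integrable (uncurry fun (U : GaugeConfig d N G) (g : Site d L → G) =>
      F (gaugeTransform g (Bl U)) * w U) (μ.prod π) := by
    refine Integrable.mono' ((hwi.norm.const_mul C).comp_fst π) ?_ (ae_of_all _ ?_)
    · exact ((hF.comp (measurable_gaugeTransform₂.comp
        (measurable_snd.prodMk (hBl.comp measurable_fst)))).mul
          (hwm.comp measurable_fst)).aestronglyMeasurable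
    · rintro ⟨U, g⟩
      simp only [uncurry_apply_pair, norm_mul, Real.norm_eq_abs]
      exact mul_le_mul_of_nonneg_right (hC _) (abs_nonneg _)
  calc ∫ U, (∫ g, F (gaugeTransform g (Bl U)) ∂π) * w U ∂μ
      = ∫ U, ∫ g, F (gaugeTransform g (Bl U)) * w U ∂π ∂μ := by
        congr 1; funext U; exact (integral_mul_const (w U) _).symm
    _ = ∫ g, ∫ U, F (gaugeTransform g (Bl U)) * w U ∂μ ∂π := integral_integral_swap hint
    _ = ∫ U, F (Bl U) * w U ∂μ := by simp only [hA, integral_const, probReal_univ, one_smul]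

end Haar

end GaugeAveraging

/-- **Registered sub-goal of Stub 3 (`stub_gaugeAveraging`) carried by this support file** — the
factorisation of the joint Haar average for the `SU(3)` theory in `d = 4`: for slab observables
`F₁, F₂` supported on links of time `< h` and a shift `h < t ≤ M/2`,
`∫ F₁(g•V) F₂(τ_t(g•V)) dg = (∫ F₁(g•V) dg) (∫ F₂(g•τ_t V) dg)` (`haarAvg_mul_shift`). [folklore] -/
theorem stub_gaugeAveraging_haarFactorisation : ∀ (M h t : ℕ) [NeZero M], h < t → 2 * t ≤ M → ∀ (F₁ F₂ : GaugeConfig 4 M ↥(Matrix.specialUnitaryGroup (Fin 3) ℂ) → ℝ), Measurable F₁ → Measurable F₂ → DependsOn F₁ {e | (e.1 0).val < h} → DependsOn F₂ {e | (e.1 0).val < h} → ∀ V, ∫ g, F₁ (gaugeTransform g V) * F₂ (torusConfigShift (Pi.single 0 (t : ZMod M)) (gaugeTransform g V)) ∂Measure.pi (fun _ : Site 4 M => haarProbability ↥(Matrix.specialUnitaryGroup (Fin 3) ℂ)) = (∫ g, F₁ (gaugeTransform g V) ∂Measure.pi (fun _ : Site 4 M => haarProbability ↥(Matrix.specialUnitaryGroup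 (Fin 3) ℂ))) * ∫ g, F₂ (gaugeTransform g (torusConfigShift (Pi.single 0 (t : ZMod M)) V)) ∂Measure.pi fun _ : Site 4 M => haarProbability ↥(Matrix.specialUnitaryGroup (Fin 3) ℂ) :=
  fun _ _ _ _ hht h2t _ _ hF₁ hF₂ hd₁ hd₂ V =>
    GaugeAveraging.haarAvg_mul_shift hht h2t hF₁ hF₂ hd₁ hd₂ V

end Summit.QuantumFields.QCD.Cruxes.RobustYangMillsRG.Birth
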